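import Summits.ABC.IUTFork.Joshi.InitialThetaDataJoshi
import Summits.ABC.IUTFork.Joshi.ATS4Differents
import Literature.NumberTheory.NumberFields.RelativeDifferentExponents
import HarnessLib

/-!
# [J-IV] §4.1 over a GENUINE curve: the merge-debt `ATS4.ReductionDatum` (T-26) ↔ `ATS3.Voddss` (T-06), closed in kernel

Record file (D-0012) of the abc-iut cell, block E «type Joshi's construction, test vs S» (rung LADDER-ABC:A2.E; seat
abc-iut-E-t6; merge-debt reconciliation T-06 ↔ T-26 named in the docstring of E-t26's `Joshi/ATS4Differents.lean` p430056:
«the elliptic curve `C/L` … is NOT an object of this file: merge-debt = slot T-06 `Joshi/InitialThetaDataJoshi.lean`, J3 §3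
(6)–(8) `Voddss`»). TAKES NO SIDE on [IUTchIII] Cor. 3.12, on the claims of K. Joshi ([J-III] arXiv:2401.13508v4, [J-IV]
arXiv:2403.10430v2, unrefereed), or on S. Mochizuki's reports on them; typed ≠ proved; typed AS A CANDIDATE ≠ endorsed.

E-t26 types [J-IV] §4.1.1 (1), §4.1.2 (6) and Prop. 4.1.1 over an ABSTRACT reduction signature `ATS4.ReductionDatum L`
(`red : 𝕍(L)^non → {good, multiplicative, additive}`, the prime `ℓ`). Here the signature is INSTANTIATED by a genuine
elliptic curve `C/L` (`ReductionDatum.ofCurve C ℓ`: `red v` := the reduction type of `C` at `v` by the tree's local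
trichotomy `hasGoodReductionAt_or_hasMultiplicativeReductionAt_or_hasAdditiveReductionAt`, Silverman AEC VII.5), and it is
PROVED that (a) `red v = multiplicative / good / additive ↔ C.Has…ReductionAt v` (`red_ofCurve_eq_*_iff`); (b) the two
residue-characteristic conventions of the tree agree (`residueChar_eq`: `Literature.IUT.LogVolume.residueChar L v` = the
positive generator of `v ∩ ℤ`, [IUTchIV] side, equals `Literature.IUT.HodgeTheaters.residueChar (FinitePlace.mk v)` = the
characteristic of the residue ring, [IUTchI] §0 side); (c) E-t26's `V^{odd,ss}_L` ([J-IV] p.38 l.15–16) of the instantiated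
datum IS E-t6's `ATS3.Voddss C L` ([J-III] §3.2 (6)/(8), multiplicative reading) transported along `FinitePlace.mk`
(`mem_voddss_ofCurve_iff`). Hence [J-IV] Prop. 4.1.1 / §4.1.1 (1) for the curve read through `ofCurve` are statements about
`C`'s reduction types (`prop411_1_ofCurve_iff` etc.); they remain CLAIMS (never asserted). No new `Prop` fact.
[claim: Joshi2024ATS3, status: disputed] [claim: Joshi2024ATS4, status: disputed]
-/

noncomputable section

open scoped Classical
open NumberField IsDedekindDomain
open Literature.IUT.HodgeTheaters hiding InitialThetaData residueChar

universe u

namespace Summit.ABC.IUTFork.Joshi.ATS4.ReductionDatum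

variable {L : Type u} [Field L] [NumberField L] (C : WeierstrassCurve L) (ℓ : ℕ)

/-! ## The two residue characteristics of the tree agree -/

/-- `p_v` two ways: the positive generator of `𝔭_v ∩ ℤ` (`Literature.IUT.LogVolume.residueChar`, [IUTchIV] files) equals the
characteristic of the residue ring `𝓞_L/𝔭_v` (`Literature.IUT.HodgeTheaters.residueChar`, [IUTchI] §0 files) — both are the
unique prime `p` with `(p) ⊆ 𝔭_v`. PROVED. [cite: NeukirchANT1999, Ch. I (8.2)] -/
theorem residueChar_eq (v : HeightOneSpectrum (𝓞 L)) :
    Literature.IUT.LogVolume.residueChar L v = Literature.IUT.HodgeTheaters.residueChar (FinitePlace.mk v) := by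
  -- both divide exactly the naturals `n` with `(n : 𝓞 L) ∈ 𝔭_v`
  have key : ∀ n : ℕ, Literature.IUT.LogVolume.residueChar L v ∣ n ↔
      Literature.IUT.HodgeTheaters.residueChar (FinitePlace.mk v) ∣ n := by
    intro n
    unfold Literature.IUT.HodgeTheaters.residueChar
    rw [FinitePlace.maximalIdeal_mk, ← ringChar.spec, ← map_natCast (Ideal.Quotient.mk v.asIdeal),
      Ideal.Quotient.eq_zero_iff_mem]
    exact (Literature.NumberTheory.NumberFields.natCast_mem_iff_absNorm_under_dvd L v.asIdeal n).symm
  exact Nat.dvd_antisymm ((key _).mpr dvd_rfl) ((key _).mp dvd_rfl)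

/-! ## The reduction signature of a genuine curve -/

/-- **E-t26's `ReductionDatum L` INSTANTIATED by an elliptic curve `C/L` and the prime `ℓ`** ([J-IV] §4.1, p.37 l.29–p.38 l.10:
«`C/L` has good reduction at …», «`ℓ ≥ 5` is a prime»): `red v` = the reduction type of `C` at `v` (good / multiplicative /
additive, decided by the tree's local trichotomy, Silverman AEC VII.5 Prop. 5.1). A DEFINITION; nothing asserted.
[claim: Joshi2024ATS4, status: disputed] -/
def ofCurve : ReductionDatum L where
  red v := if C.HasGoodReductionAt v then .good
    else if C.HasMultiplicativeReductionAt v then .multiplicative else .additive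
  ell := ℓ

/-- The prime of the instantiated datum is `ℓ`. [folklore] -/
theorem ofCurve_ell : (ofCurve C ℓ).ell = ℓ := rfl

/-- `red v = good ↔ C` has good reduction at `v`. PROVED. [folklore] -/
theorem red_ofCurve_eq_good_iff (v : HeightOneSpectrum (𝓞 L)) :
    (ofCurve C ℓ).red v = .good ↔ C.HasGoodReductionAt v := by
  unfold ofCurve
  by_cases hg : C.HasGoodReductionAt v
  · simp [hg]
  · by_cases hm : C.HasMultiplicativeReductionAt v <;> simp [hg, hm]

/-- `red v = multiplicative ↔ C` has multiplicative reduction at `v` (good and multiplicative reduction exclude each other).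
PROVED. [folklore] -/
theorem red_ofCurve_eq_multiplicative_iff (v : HeightOneSpectrum (𝓞 L)) :
    (ofCurve C ℓ).red v = .multiplicative ↔ C.HasMultiplicativeReductionAt v := by
  unfold ofCurve
  by_cases hg : C.HasGoodReductionAt v
  · simp [hg, hg.not_hasMultiplicativeReductionAt]
  · by_cases hm : C.HasMultiplicativeReductionAt v <;> simp [hg, hm]

/-- `red v = additive ↔ C` has additive reduction at `v` (local trichotomy and exclusivity). PROVED. [folklore] -/
theorem red_ofCurve_eq_additive_iff (v : HeightOneSpectrum (𝓞 L)) :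
    (ofCurve C ℓ).red v = .additive ↔ C.HasAdditiveReductionAt v := by
  unfold ofCurve
  by_cases hg : C.HasGoodReductionAt v
  · simp [hg, hg.not_hasAdditiveReductionAt]
  · by_cases hm : C.HasMultiplicativeReductionAt v
    · simp [hg, hm, hm.not_hasAdditiveReductionAt]
    · simp only [hg, hm, if_false, true_iff]
      rcases C.hasGoodReductionAt_or_hasMultiplicativeReductionAt_or_hasAdditiveReductionAt v with h | h | h
      · exact absurd h hg
      · exact absurd h hm
      · exact h

/-! ## `V^{odd,ss}_L`: E-t26's set of the instantiated datum = E-t6's `ATS3.Voddss C L` -/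

omit [NumberField L] in
/-- `C ×_L L = C` (base change along the identity). [folklore] -/
theorem baseChange_self : C.baseChange L = C := by
  cases C
  rfl

/-- **Merge-debt T-06 ↔ T-26 closed**: for a finite place `v` of `L`, `v ∈ V^{odd,ss}_L` in E-t26's sense for the datum of the
curve ([J-IV] p.38 l.15–16: odd residue characteristic, bad multiplicative reduction) iff the finite place `FinitePlace.mk v`
lies in E-t6's `ATS3.Voddss C L` ([J-III] §3.2 (6)/(8), multiplicative reading). PROVED. [claim: Joshi2024ATS4, status: disputed] -/
theorem mem_voddss_ofCurve_iff [C.IsElliptic] (v : HeightOneSpectrum (𝓞 L)) :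
    v ∈ (ofCurve C ℓ).Voddss ↔ FinitePlace.mk v ∈ ATS3.Voddss C L := by
  show Odd (Literature.IUT.LogVolume.residueChar L v) ∧ (ofCurve C ℓ).red v = .multiplicative ↔
    Odd (Literature.IUT.HodgeTheaters.residueChar (FinitePlace.mk v)) ∧
      (C.baseChange L).HasMultiplicativeReductionAt (FinitePlace.mk v).maximalIdeal
  rw [residueChar_eq, red_ofCurve_eq_multiplicative_iff, baseChange_self, FinitePlace.maximalIdeal_mk]

/-- The same at a finite place given as `w : FinitePlace L`. PROVED. [claim: Joshi2024ATS4, status: disputed] -/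
theorem maximalIdeal_mem_voddss_ofCurve_iff [C.IsElliptic] (w : FinitePlace L) :
    w.maximalIdeal ∈ (ofCurve C ℓ).Voddss ↔ w ∈ ATS3.Voddss C L := by
  rw [mem_voddss_ofCurve_iff, FinitePlace.mk_maximalIdeal]

/-! ## [J-IV] §4.1.1 (1) and Prop. 4.1.1 read on the curve -/

/-- §4.1.1 (1) for the datum of `C` («`C/L` has good reduction at `v ∈ V^good_L ∩ V^non_L ∩ {v ∤ 2ℓ}`», p.37 l.33–35) unfolds to:
every finite place of odd residue characteristic not dividing `2ℓ` at which `C` is not multiplicative is a place of GOOD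
reduction. PROVED (unfolding). [claim: Joshi2024ATS4, status: disputed] -/
theorem goodReductionHyp_ofCurve_iff :
    (ofCurve C ℓ).GoodReductionHyp ↔ ∀ v : HeightOneSpectrum (𝓞 L),
      ¬ (Odd (Literature.IUT.LogVolume.residueChar L v) ∧ C.HasMultiplicativeReductionAt v) →
        ¬ Literature.IUT.LogVolume.residueChar L v ∣ 2 * ℓ → C.HasGoodReductionAt v := by
  refine forall_congr' fun v => ?_
  rw [← red_ofCurve_eq_multiplicative_iff C ℓ, ← red_ofCurve_eq_good_iff C ℓ]
  rfl

/-- Prop. 4.1.1 (1) for the datum of `C` («`C/L` has semistable [= bad multiplicative] reduction at `v` iff `v ∈ V^{odd,ss}`»,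
p.38 l.15–16) unfolds to: every multiplicative place of `C` has odd residue characteristic. PROVED (unfolding).
[claim: Joshi2024ATS4, status: disputed] -/
theorem prop411_1_ofCurve_iff :
    (ofCurve C ℓ).Prop411_1 ↔ ∀ v : HeightOneSpectrum (𝓞 L),
      C.HasMultiplicativeReductionAt v → Odd (Literature.IUT.LogVolume.residueChar L v) := by
  refine forall_congr' fun v => ?_
  rw [ReductionDatum.Voddss, Set.mem_setOf_eq, red_ofCurve_eq_multiplicative_iff]
  tauto

/-- Prop. 4.1.1 (2) for the datum of `C` («good or additive reduction if `v | 2ℓ`», p.38 l.17) unfolds to: `C` is NOT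
multiplicative at the places dividing `2ℓ`. PROVED (unfolding + trichotomy). [claim: Joshi2024ATS4, status: disputed] -/
theorem prop411_2_ofCurve_iff :
    (ofCurve C ℓ).Prop411_2 ↔ ∀ v : HeightOneSpectrum (𝓞 L),
      Literature.IUT.LogVolume.residueChar L v ∣ 2 * ℓ → ¬ C.HasMultiplicativeReductionAt v := by
  refine forall_congr' fun v => ?_
  refine imp_congr Iff.rfl ?_
  rw [red_ofCurve_eq_good_iff, red_ofCurve_eq_additive_iff]
  constructor
  · rintro (h | h)
    · exact h.not_hasMultiplicativeReductionAt
    · exact h.not_hasMultiplicativeReductionAt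
  · intro h
    rcases C.hasGoodReductionAt_or_hasMultiplicativeReductionAt_or_hasAdditiveReductionAt v with h' | h' | h'
    · exact Or.inl h'
    · exact absurd h' h
    · exact Or.inr h'

end Summit.ABC.IUTFork.Joshi.ATS4.ReductionDatum

end
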